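import Mathlib
import Literature.Computability.AlgebraicComplexity.EquivariantDC
import Summits.ValiantsHypothesis.ValiantsHypothesis.Statement
import Summits.ValiantsHypothesis.ValiantsHypothesis.Theses.FreeSubtorus
import Summits.ValiantsHypothesis.ValiantsHypothesis.Theorems.FreeSubtorusConfusionCoveringDefs
import Summits.ValiantsHypothesis.ValiantsHypothesis.Theorems.FreeSubtorusConfusionCovering
import Summits.ValiantsHypothesis.ValiantsHypothesis.Theorems.FreeSubtorusConfusionCoveringDial

/-!
# The rung `ConfusionCovering` by VALUE — `C(n, ⌊n/2⌋) ≤ m · κ_{⌊n/2⌋}(Λ)` — its dial and its on-path record,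
# in tree vocabulary (crux dir `OrbitDimensionBound`, stmt-ValiantsHypothesis-16133, route FreeSubtorus)

With the confusion number `confusionNumber n r Λ d = κ_d(Λ)` of `Theorems/FreeSubtorusConfusionCoveringDefs.lean`
(definitionally the crux workfile's `Confusion.confusion`), the class form of the rung
(`Theorems.FreeSubtorusConfusionCovering.confusionCovering`, p177872) becomes the VALUE form

* `confusionCovering_kappa` — for `n ≥ 3`, every `T_Λ`-equivariant (exact `GL_m × GL_m` lifts) affine determinantal
  representation of `per_n` of size `m`, `Λ : Fin r → ([n] ⊔ [n]) → ℤ` admissible, has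
  `C(n, ⌊n/2⌋) ≤ m · κ_{⌊n/2⌋}(Λ)`.  Pointwise this is DEFINITIONALLY the registered rung
  `Cruxes.OrbitDimensionBound.Confusion.ConfusionCovering` (`= CoveringRung confusionLoss`) at `n, m, r, Λ, B`.

and the rest of the forward-discipline record follows in `Theorems/` vocabulary:

* `confusionNumber_le_two_pow` — the DIAL `κ_d(Λ) ≤ 2^r` (Odlyzko 1988; tree theorem
  `card_confusedClass_le_two_pow`, from `Literature…ncard_hypercube_inter_translate_le`), hence
  `subtorusCovering_of_confusionCovering_kappa` — rung (value form) ⇒ the floor `Theses.FreeSubtorus.SubtorusCovering`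
  (`C(n,⌊n/2⌋) ≤ m · 2^r`), the F3 triangle by name of the floor;
* `confusionCovering_kappa_of_valiantsHypothesis` — the ON-PATH lemma `S → Rung` (value form): the Statement
  `ValiantsHypothesis` (`VP_ℂ ≠ VNP_ℂ`) is asymptotic and symmetry-free and implies no fixed-`n` inequality with content,
  so `S → Rung` holds exactly because the rung is a theorem;
* `choose_middle_le_mul_loss` — the same bound for every loss `L n r Λ ≥ κ_{⌊n/2⌋}(Λ)` (with `L :=` the workfile's
  `Confusion.confusionLoss` the premise is `le_rfl`: the registered rung pointwise);
* `choose_middle_le_mul_confusionNumber_of_vp_ne_vnp` — the on-path lemma in CONTEXT form, an `aesop` forward rule: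
  after `intro h; simp only [ConfusionCovering, CoveringRung, ValiantsHypothesis, Literature.PNP.ValiantHypothesis] at h ⊢`
  has exposed the registered rung's binders, `aesop` adds `n.choose (n/2) ≤ m * confusionNumber n r Λ (n/2)` to the
  context and `assumption` closes `… ≤ m * Confusion.confusionLoss n r Λ` up to definitional unfolding — so
  `ValiantsHypothesis → ConfusionCovering` is proved by that standard step in any file importing this module, without
  importing the `Cruxes/` workfile (measured: closes under `maxHeartbeats 50000` with `Summits.ValiantsHypothesis.TribunalEnv`
  in scope; the rule stays silent without the Statement premise in context).

[cite: LandsbergRessayre2017, Thm. 2.8, §6] [cite: Odlyzko1988, p. 127]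
-/

open Finset
open Literature.Computability.AlgebraicComplexity

-- the mandated summit-side namespace repeats a component by design (single-problem summit)
set_option linter.dupNamespace false

namespace Summit.ValiantsHypothesis.ValiantsHypothesis.Theorems.FreeSubtorusConfusionCovering

noncomputable section

/-- **Odlyzko's bound for the confusion number**: `κ_d(Λ) ≤ 2^r` — every confusion class injects by indicator
characters into the hypercube points of one translate of `span_ℚ {Λ_i}` (dimension `≤ r`), which holds at most `2^r`
of them (`card_confusedClass_le_two_pow`). [cite: Odlyzko1988, p. 127] -/
theorem confusionNumber_le_two_pow (n r d : ℕ) (Λ : Fin r → (Fin n ⊕ Fin n) → ℤ) :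
    confusionNumber n r Λ d ≤ 2 ^ r := by
  classical
  unfold confusionNumber
  refine Finset.sup_le fun q _ => ?_
  exact card_confusedClass_le_two_pow n r d Λ q

/-- **The rung `ConfusionCovering`, value form (PROVED).**  For `n ≥ 3`, a `T_Λ`-equivariant (exact lifts) affine
determinantal representation `B` of `per_n` of size `m`, `Λ` admissible with `r` generators, has
`C(n, ⌊n/2⌋) ≤ m · κ_{⌊n/2⌋}(Λ)`.  From the class form `confusionCovering` (some middle-level pair `q` with
`C(n,⌊n/2⌋) ≤ m · #class(q)`) and `#class(q) = confusedClassCard n r Λ (n/2) q ≤ κ_{⌊n/2⌋}(Λ)`.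
[cite: LandsbergRessayre2017, Thm. 2.8, §6] -/
theorem confusionCovering_kappa :
    ∀ n : ℕ, 3 ≤ n → ∀ (m r : ℕ) (Λ : Fin r → (Fin n ⊕ Fin n) → ℤ)
    (B : Matrix (Fin m) (Fin m) (MvPolynomial (Fin n × Fin n) ℂ)),
    (∀ i, (∑ k, Λ i (Sum.inl k)) = 0 ∧ (∑ l, Λ i (Sum.inr l)) = 0) →
    Literature.Computability.AlgebraicComplexity.IsEquivariantDetRepr
      (Subgroup.closure {γ : Matrix.GeneralLinearGroup (Fin n × Fin n) ℂ |
        ∃ d e : Fin n → ℂˣ, (∀ i, (∏ k, (d k) ^ (Λ i (Sum.inl k))) * (∏ l, (e l) ^ (Λ i (Sum.inr l))) = 1) ∧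
          (γ : Matrix (Fin n × Fin n) (Fin n × Fin n) ℂ) = Matrix.diagonal (fun p => (d p.1 : ℂ) * (e p.2 : ℂ))})
      (Literature.Computability.AlgebraicComplexity.perPoly (Fin n) ℂ) B →
    n.choose (n / 2) ≤ m * confusionNumber n r Λ (n / 2) := by
  intro n hn m r Λ B hΛ hB
  obtain ⟨q, hq1, hq2, hle⟩ := confusionCovering n hn m r Λ B hΛ hB
  exact hle.trans (Nat.mul_le_mul_left m (confusedClassCard_le_confusionNumber Λ q hq1 hq2))

/-- **The rung for every loss dominating the confusion number.**  In the context of a `T_Λ`-equivariant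
representation (`hB`) of `per_n`, `n ≥ 3`, `Λ` admissible, every loss function `L` with `κ_{⌊n/2⌋}(Λ) ≤ L(n, r, Λ)`
satisfies `C(n, ⌊n/2⌋) ≤ m · L(n, r, Λ)`; with `L :=` the workfile's `Confusion.confusionLoss` the premise `hL` is
`le_rfl` (definitional unfolding), giving the registered rung pointwise. [cite: LandsbergRessayre2017, Thm. 2.8, §6] -/
theorem choose_middle_le_mul_loss {n m r : ℕ} {Λ : Fin r → (Fin n ⊕ Fin n) → ℤ}
    {B : Matrix (Fin m) (Fin m) (MvPolynomial (Fin n × Fin n) ℂ)}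
    (L : (n r : ℕ) → (Fin r → (Fin n ⊕ Fin n) → ℤ) → ℕ)
    (hB : Literature.Computability.AlgebraicComplexity.IsEquivariantDetRepr
      (Subgroup.closure {γ : Matrix.GeneralLinearGroup (Fin n × Fin n) ℂ |
        ∃ d e : Fin n → ℂˣ, (∀ i, (∏ k, (d k) ^ (Λ i (Sum.inl k))) * (∏ l, (e l) ^ (Λ i (Sum.inr l))) = 1) ∧
          (γ : Matrix (Fin n × Fin n) (Fin n × Fin n) ℂ) = Matrix.diagonal (fun p => (d p.1 : ℂ) * (e p.2 : ℂ))})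
      (Literature.Computability.AlgebraicComplexity.perPoly (Fin n) ℂ) B)
    (hn : 3 ≤ n) (hΛ : ∀ i, (∑ k, Λ i (Sum.inl k)) = 0 ∧ (∑ l, Λ i (Sum.inr l)) = 0)
    (hL : confusionNumber n r Λ (n / 2) ≤ L n r Λ) :
    n.choose (n / 2) ≤ m * L n r Λ :=
  (confusionCovering_kappa n hn m r Λ B hΛ hB).trans (Nat.mul_le_mul_left m hL)

/-- **ON-PATH LEMMA `S → Rung` in context form (kernel-visible).**  Under the Statement in its unfolded form
`VP_ℂ ≠ VNP_ℂ` (idle: the rung is a theorem) and in the context of a `T_Λ`-equivariant representation `B` of `per_n`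
(`n ≥ 3`, `Λ` admissible): `C(n, ⌊n/2⌋) ≤ m · κ_{⌊n/2⌋}(Λ)`.  Registered as an `aesop` forward rule: once
`intro h; simp only [ConfusionCovering, CoveringRung, ValiantsHypothesis, Literature.PNP.ValiantHypothesis] at h ⊢`
has exposed the registered rung's binders, `aesop` adds this bound to the context and closes the goal
`n.choose (n/2) ≤ m * Confusion.confusionLoss n r Λ` by `assumption` up to definitional unfolding
(`confusionNumber n r Λ (n/2)` IS `Confusion.confusionLoss n r Λ`) — so `ValiantsHypothesis → ConfusionCovering` is
proved by the standard portfolio in any file importing this module, without importing the `Cruxes/` workfile.  The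
Statement premise keeps the rule silent in contexts that do not carry the summit. [folklore] -/
@[aesop safe forward]
theorem choose_middle_le_mul_confusionNumber_of_vp_ne_vnp {n m r : ℕ} {Λ : Fin r → (Fin n ⊕ Fin n) → ℤ}
    {B : Matrix (Fin m) (Fin m) (MvPolynomial (Fin n × Fin n) ℂ)}
    (_hS : Literature.Computability.AlgebraicComplexity.VP ℂ ≠ Literature.Computability.AlgebraicComplexity.VNP ℂ)
    (hB : Literature.Computability.AlgebraicComplexity.IsEquivariantDetRepr
      (Subgroup.closure {γ : Matrix.GeneralLinearGroup (Fin n × Fin n) ℂ |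
        ∃ d e : Fin n → ℂˣ, (∀ i, (∏ k, (d k) ^ (Λ i (Sum.inl k))) * (∏ l, (e l) ^ (Λ i (Sum.inr l))) = 1) ∧
          (γ : Matrix (Fin n × Fin n) (Fin n × Fin n) ℂ) = Matrix.diagonal (fun p => (d p.1 : ℂ) * (e p.2 : ℂ))})
      (Literature.Computability.AlgebraicComplexity.perPoly (Fin n) ℂ) B)
    (hn : 3 ≤ n) (hΛ : ∀ i, (∑ k, Λ i (Sum.inl k)) = 0 ∧ (∑ l, Λ i (Sum.inr l)) = 0) :
    n.choose (n / 2) ≤ m * confusionNumber n r Λ (n / 2) :=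
  confusionCovering_kappa n hn m r Λ B hΛ hB

/-- **ON-PATH LEMMA `S → Rung` (value form).**  The Statement `ValiantsHypothesis` (`VP_ℂ ≠ VNP_ℂ`) implies the rung
`C(n, ⌊n/2⌋) ≤ m · κ_{⌊n/2⌋}(Λ)` for equivariant representations of `per_n` — because the rung is a theorem
(`confusionCovering_kappa`); what the summit implies WITH content is only the rung's asymptotic shadow (workfile
`Confusion.confusionShadow_of_summit`). [folklore] -/
theorem confusionCovering_kappa_of_valiantsHypothesis : _root_.ValiantsHypothesis →
    ∀ n : ℕ, 3 ≤ n → ∀ (m r : ℕ) (Λ : Fin r → (Fin n ⊕ Fin n) → ℤ)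
    (B : Matrix (Fin m) (Fin m) (MvPolynomial (Fin n × Fin n) ℂ)),
    (∀ i, (∑ k, Λ i (Sum.inl k)) = 0 ∧ (∑ l, Λ i (Sum.inr l)) = 0) →
    Literature.Computability.AlgebraicComplexity.IsEquivariantDetRepr
      (Subgroup.closure {γ : Matrix.GeneralLinearGroup (Fin n × Fin n) ℂ |
        ∃ d e : Fin n → ℂˣ, (∀ i, (∏ k, (d k) ^ (Λ i (Sum.inl k))) * (∏ l, (e l) ^ (Λ i (Sum.inr l))) = 1) ∧
          (γ : Matrix (Fin n × Fin n) (Fin n × Fin n) ℂ) = Matrix.diagonal (fun p => (d p.1 : ℂ) * (e p.2 : ℂ))})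
      (Literature.Computability.AlgebraicComplexity.perPoly (Fin n) ℂ) B →
    n.choose (n / 2) ≤ m * confusionNumber n r Λ (n / 2) :=
  fun _ => confusionCovering_kappa

/-- **Rung (value form) ⇒ floor**, by name of the floor: `C(n,⌊n/2⌋) ≤ m · κ_{⌊n/2⌋}(Λ)` for all equivariant
representations gives `Theses.FreeSubtorus.SubtorusCovering` (`… ≤ m · 2^r`) through the dial
`confusionNumber_le_two_pow` — the F3 triangle rung ⇒ floor with the floor's registered statement as conclusion.
[cite: LandsbergRessayre2017, Thm. 2.8, §6] [cite: Odlyzko1988, p. 127] -/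
theorem subtorusCovering_of_confusionCovering_kappa
    (h : ∀ n : ℕ, 3 ≤ n → ∀ (m r : ℕ) (Λ : Fin r → (Fin n ⊕ Fin n) → ℤ)
      (B : Matrix (Fin m) (Fin m) (MvPolynomial (Fin n × Fin n) ℂ)),
      (∀ i, (∑ k, Λ i (Sum.inl k)) = 0 ∧ (∑ l, Λ i (Sum.inr l)) = 0) →
      Literature.Computability.AlgebraicComplexity.IsEquivariantDetRepr
        (Subgroup.closure {γ : Matrix.GeneralLinearGroup (Fin n × Fin n) ℂ |
          ∃ d e : Fin n → ℂˣ, (∀ i, (∏ k, (d k) ^ (Λ i (Sum.inl k))) * (∏ l, (e l) ^ (Λ i (Sum.inr l))) = 1) ∧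
            (γ : Matrix (Fin n × Fin n) (Fin n × Fin n) ℂ) = Matrix.diagonal (fun p => (d p.1 : ℂ) * (e p.2 : ℂ))})
        (Literature.Computability.AlgebraicComplexity.perPoly (Fin n) ℂ) B →
      n.choose (n / 2) ≤ m * confusionNumber n r Λ (n / 2)) :
    Summit.ValiantsHypothesis.ValiantsHypothesis.Theses.FreeSubtorus.SubtorusCovering :=
  fun n hn m r Λ B hΛ hB =>
    (h n hn m r Λ B hΛ hB).trans (Nat.mul_le_mul_left m (confusionNumber_le_two_pow n r (n / 2) Λ))

/-- The floor once more, THROUGH the value-form rung (rung proved ∘ dial); an `example`, the floor being the landed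
theorem `Theorems.FreeSubtorusSubtorusCovering.subtorusCovering_proof`. [cite: LandsbergRessayre2017, Thm. 2.8] -/
example : Summit.ValiantsHypothesis.ValiantsHypothesis.Theses.FreeSubtorus.SubtorusCovering :=
  subtorusCovering_of_confusionCovering_kappa confusionCovering_kappa

end

end Summit.ValiantsHypothesis.ValiantsHypothesis.Theorems.FreeSubtorusConfusionCovering
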